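import Summits.CriticalPhenomena.PercolationContinuityZ3.Theorems.Transplant.PlanarSkeletonFrmFromDefs
import Summits.CriticalPhenomena.PercolationContinuityZ3.Theorems.Transplant.SkelFrmFromBFaceBVC2
import Summits.CriticalPhenomena.PercolationContinuityZ3.Theorems.Transplant.SkelFrmBFaceBVC2
import Summits.CriticalPhenomena.PercolationContinuityZ3.Theorems.Transplant.SkelFrmFromBFaceFrameRowsV
import Summits.CriticalPhenomena.PercolationContinuityZ3.Theorems.Transplant.SkelFrmBFaceFrameRowsV
import Summits.CriticalPhenomena.PercolationContinuityZ3.Theorems.Transplant.SkelFrmFromBParamsSlotsS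
import Summits.CriticalPhenomena.PercolationContinuityZ3.Theorems.Transplant.SkelFrmBParamsSlotsS
import Summits.CriticalPhenomena.PercolationContinuityZ3.Theorems.Transplant.SkelFrmFromBChoiceZoneK
import Summits.CriticalPhenomena.PercolationContinuityZ3.Theorems.Transplant.SkelFrmBChoiceZoneK
import Summits.CriticalPhenomena.PercolationContinuityZ3.Theorems.Transplant.SkelFrmFromBChoiceLinks
import Summits.CriticalPhenomena.PercolationContinuityZ3.Theorems.Transplant.SkelFrmBChoiceLinks
import Summits.CriticalPhenomena.PercolationContinuityZ3.Theorems.Transplant.SkelFrmFrom1RootHoldsQC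
import Summits.CriticalPhenomena.PercolationContinuityZ3.Theorems.Transplant.SkelFrm1RootHoldsQC
import Summits.CriticalPhenomena.PercolationContinuityZ3.Theorems.Transplant.SkelFrmFromBChoiceDefsV
import Summits.CriticalPhenomena.PercolationContinuityZ3.Theorems.Transplant.SkelFrmBChoiceDefsV
import Summits.CriticalPhenomena.PercolationContinuityZ3.Theorems.Transplant.SkelFrmFromBParamsSchedA
import Summits.CriticalPhenomena.PercolationContinuityZ3.Theorems.Transplant.SkelFrmBParamsSchedA
import HarnessLib
import Summits.CriticalPhenomena.PercolationContinuityZ3.Theorems.Transplant.SkelFrmBFaceBVC3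
/-!
# U-WAVE PORT (RULING D-U, lead g21 2026-08-26; WAVE-U-MANIFEST v3.0 row «SkelFrmBFaceBVC3» ↦ «SkelFrmFromBFaceBVC3») of the tree module
# `Transplant/SkelFrmBFaceBVC3` onto the carrier `PlanarSkeletonFrmFrom` (frames only, cylinders connected from width `ℓ₀` on)

ORIGINAL TITLE: N2 (frames-only node, OPEN) — (F) column, THE WRAPPER's LAYER (a3): `NegB.faceOblRM_frmBVC₃` = layer (a2) `faceOblRM_frmBVC₂` AT THE BLOCK SLOT OF RECORD

builds on p205010 (kernel theorem, internal audit signed; external expert review pending) — nothing in this file uses p205010; NOTHING is claimed about the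
OPEN node U `SamePDropOfSkeletonFrmFrom₁` (nor U_s / the end state).  Lane `prim-bschramm`, seat `prim-hp-8 gen 53 (U-wave port pen, family P-hp8; tool of record = p3-g26 port_u.py)`; helper file
(`--supports stmt-CriticalPhenomena-4575 --as helper`).  PORT RULES r1–r4 of RULING D-U: declaration order and proof texts are those of the original,
byte-identical except (i) the carrier token `PlanarSkeletonFrm ↦ PlanarSkeletonFrmFrom` (binders, `namespace`/`end` lines, qualified names of twinned
declarations), (ii) carrier-FREE declarations of the original (φ-level `Skelφ…` blocks and namespace-only arithmetic residents) are NOT re-declared —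
this file imports the original and `export`s the twin-free residents (POLICY T / treatment (m1)); residents whose statement mentions a twinned
constant are copied, (iii) every carrier-binding declaration keeps its explicit binder `(Φ : PlanarSkeletonFrmFrom G)` in its own signature (r2).  Docstrings and citations are the original's.  Manifest row idx 234 (level 30; flags verbatim|MIXED(m1)); filed by the hp-8 lineage under RULING M-11 (family P-hp8).
-/

noncomputable section

open scoped Classical ENNReal

namespace Summit.CriticalPhenomena.PercolationContinuityZ3.Theorems.Transplant

namespace PlanarSkeletonFrmFrom

namespace NegB

open MeasureTheory Literature.Probability.Percolation Literature.Probability.LatticeModels SimpleGraph KNCells KNLevels GadgetSystem Contour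
open Literature.Probability.Percolation.KozmaNitzan
open Literature.Probability.Percolation.KozmaNitzan.Cells (oth sgOf sgOf_sign stepVec_apply_fst)
open Literature.Barriers.CriticalPhenomena (graphBall mem_graphBall_self graphBall_mono)
open BoxProdZ2 (ConcRadiiG Erad Frad nQ nS)
open ChainPlanar ChainPara
open Skel (winGraph routeW excess WinStepData)
open SkelI (tanOff)
open TwoAxis.Para (modulus detD rep₂)
open SkelConc (Consts)
open Skelφ
open Skelφ.StepI (DataNS OutNS)
open Neg

variable {κ : Consts} {V : Type} [DecidableEq V] [Countable V] {G : SimpleGraph V} [G.LocallyFinite] {Φ : PlanarSkeletonFrmFrom G} {t : V}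
  {p : unitInterval} {Pv : NegB.PSlot} {cv hv : NegB.CSlot} {hC : Φ.CylSubcritical p}
  {O : OutNS V} {q : unitInterval}

set_option maxHeartbeats 3200000 in
/-- **Layer (a3) of the (F) wrapper at the Q3V tuple: the kit block discharged at the block slot of record** (see the module docstring).
[cite: KozmaNitzan2024, §4 Lemma 10 (pp. 17–21), Lemma 12 (pp. 23–25)] -/
theorem faceOblRM_frmBVC₃ {κ : Consts} {V : Type} [DecidableEq V] [Countable V] {G : SimpleGraph V} [G.LocallyFinite] {Φ : PlanarSkeletonFrmFrom G} {t : V} {p : unitInterval} {Pv : NegB.PSlot} {cv : NegB.CSlot} {hv : NegB.CSlot} {hC : Φ.CylSubcritical p} {O : OutNS V} {q : unitInterval}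
    (mk cW : ℕ)
    (gx fx : Neg.FSlot)
    (hgx : ∀ D : DataNS V, gxFc mk cW κ Φ t p D ≤ gx κ Φ t p D)
    (hfx : ∀ D : DataNS V, fxFc mk κ Φ t p D ≤ fx κ Φ t p D)
    (ex mx : GSlot) (hmx : (prFA κ Φ t p O.merged (KS.gT mk gx κ Φ t p O.merged) (KS.fT mk fx κ Φ t p O.merged)).mF (fcellsA κ Φ t p O.merged (KS.gT mk gx κ Φ t p O.merged) (KS.fT mk fx κ Φ t p O.merged)) ≤ (((mx κ Φ t p O.merged (KS.gT mk gx κ Φ t p O.merged) (KS.fT mk fx κ Φ t p O.merged)) : ℕ) : ℤ))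
    (hAt : (choiceAtQ3V κ Φ t p Pv (KS.gT mk gx) (KS.fT mk fx) (SUS ex mx) cv hv BSlot.small3 hC).AtQNQ O q)
    (h1 : Φ.types = {t}) (hp0 : 0 < (p : ℝ)) (hp1 : (p : ℝ) < 1)
    (hMR0 : 4 * Neg.K κ * (KS0.R'0 κ Φ t p O.merged mk + 2) ≤ ML κ Φ t p O.merged (KS.gT mk gx κ Φ t p O.merged))
    -- the binders of `faceOblRM_fineNb2V` (schemeO side)
    (hL' : 1 ≤ (Skelφ.Prm.Lp ((SUS ex mx) κ Φ t p O.merged (KS.gT mk gx κ Φ t p O.merged) (KS.fT mk fx κ Φ t p O.merged) q)))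
    -- the binders of the keystone `hkits_faceSteps_of_nums6` (kit / route / Λ / numbers)
    (hΔg : ∀ v, G.degree v ≤ Φ.Δ)
    (hA0 : 0 < (prFA κ Φ t p O.merged (KS.gT mk gx κ Φ t p O.merged) (KS.fT mk fx κ Φ t p O.merged)).A)
    (hnL : 1 ≤ (nL κ Φ t p O.merged (KS.gT mk gx κ Φ t p O.merged) (KS.fT mk fx κ Φ t p O.merged)))
    (hvL : |(prFA κ Φ t p O.merged (KS.gT mk gx κ Φ t p O.merged) (KS.fT mk fx κ Φ t p O.merged)).vα| ≤ (nL κ Φ t p O.merged (KS.gT mk gx κ Φ t p O.merged) (KS.fT mk fx κ Φ t p O.merged)))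
    (hmf : 0 ≤ modulus (nL κ Φ t p O.merged (KS.gT mk gx κ Φ t p O.merged) (KS.fT mk fx κ Φ t p O.merged)) (prFA κ Φ t p O.merged (KS.gT mk gx κ Φ t p O.merged) (KS.fT mk fx κ Φ t p O.merged)).h (prFA κ Φ t p O.merged (KS.gT mk gx κ Φ t p O.merged) (KS.fT mk fx κ Φ t p O.merged)).vα (prFA κ Φ t p O.merged (KS.gT mk gx κ Φ t p O.merged) (KS.fT mk fx κ Φ t p O.merged)).vβ)
    {r : ℕ}
    -- THE ROUTE BLOCK (c-uniform; all signs)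
    (hB : BridgeOK (KS.BFs κ Φ t p O.merged cW mk (KS.gT mk gx κ Φ t p O.merged) (KS.fT mk fx κ Φ t p O.merged) 1))
    (hlay : ((nL κ Φ t p O.merged (KS.gT mk gx κ Φ t p O.merged) (KS.fT mk fx κ Φ t p O.merged)) + (prFA κ Φ t p O.merged (KS.gT mk gx κ Φ t p O.merged) (KS.fT mk fx κ Φ t p O.merged)).h.natAbs : ℕ) ≤ ((nL κ Φ t p O.merged (KS.gT mk gx κ Φ t p O.merged) (KS.fT mk fx κ Φ t p O.merged)) : ℤ) * (ℓL κ Φ t p O.merged (KS.gT mk gx κ Φ t p O.merged) (KS.fT mk fx κ Φ t p O.merged)) + 1)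
    (hRl₁ : (KS0.Rlev0 κ Φ t p O.merged mk) + 1 ≤ (KS.BFs κ Φ t p O.merged cW mk (KS.gT mk gx κ Φ t p O.merged) (KS.fT mk fx κ Φ t p O.merged) 1).R')
    (hB0 : Finset.Icc (Skelφ.pt (nL κ Φ t p O.merged (KS.gT mk gx κ Φ t p O.merged) (KS.fT mk fx κ Φ t p O.merged)) (1 * (prFA κ Φ t p O.merged (KS.gT mk gx κ Φ t p O.merged) (KS.fT mk fx κ Φ t p O.merged)).h)) (Skelφ.pt (nL κ Φ t p O.merged (KS.gT mk gx κ Φ t p O.merged) (KS.fT mk fx κ Φ t p O.merged)) (1 * (prFA κ Φ t p O.merged (KS.gT mk gx κ Φ t p O.merged) (KS.fT mk fx κ Φ t p O.merged)).h + (ℓL κ Φ t p O.merged (KS.gT mk gx κ Φ t p O.merged) (KS.fT mk fx κ Φ t p O.merged)))) ⊆ Finset.Icc (KS.BFs κ Φ t p O.merged cW mk (KS.gT mk gx κ Φ t p O.merged) (KS.fT mk fx κ Φ t p O.merged) 1).B₀lo (KS.BFs κ Φ t p O.merged cW mk (KS.gT mk gx κ Φ t p O.merged) (KS.fT mk fx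 κ Φ t p O.merged) 1).B₀hi)
    (hRlr : (RL κ Φ t p O (KS.gT mk gx) (KS.fT mk fx)) ≤ r)
    -- the near-`c` block READ BY THE TWO LATTICE FUNCTIONALS (L-F2): bridge regions (every frame sign), hop prism, zone box, fine extents `kA`
    {Λ₀ Λ₁ : ℤ}
    (hΛR : ∀ x ∈ Finset.Icc (KS.BFs κ Φ t p O.merged cW mk (KS.gT mk gx κ Φ t p O.merged) (KS.fT mk fx κ Φ t p O.merged) 1).regionLo (KS.BFs κ Φ t p O.merged cW mk (KS.gT mk gx κ Φ t p O.merged) (KS.fT mk fx κ Φ t p O.merged) 1).regionHi, |(prFA κ Φ t p O.merged (KS.gT mk gx κ Φ t p O.merged) (KS.fT mk fx κ Φ t p O.merged)).vβ * (1 * x 0) - (prFA κ Φ t p O.merged (KS.gT mk gx κ Φ t p O.merged) (KS.fT mk fx κ Φ t p O.merged)).vα * x 1| ≤ Λ₀ ∧ |((nL κ Φ t p O.merged (KS.gT mk gx κ Φ t p O.merged) (KS.fT mk fx κ Φ t p O.merged)) : ℤ) * x 1 - (prFA κ Φ t p O.merged (KS.gT mk gx κ Φ t p O.merged) (KS.fT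 mk fx κ Φ t p O.merged)).h * (1 * x 0)| ≤ Λ₁)
    (hΛQ0 : modulus (nL κ Φ t p O.merged (KS.gT mk gx κ Φ t p O.merged) (KS.fT mk fx κ Φ t p O.merged)) (prFA κ Φ t p O.merged (KS.gT mk gx κ Φ t p O.merged) (KS.fT mk fx κ Φ t p O.merged)).h (prFA κ Φ t p O.merged (KS.gT mk gx κ Φ t p O.merged) (KS.fT mk fx κ Φ t p O.merged)).vα (prFA κ Φ t p O.merged (KS.gT mk gx κ Φ t p O.merged) (KS.fT mk fx κ Φ t p O.merged)).vβ + ((nL κ Φ t p O.merged (KS.gT mk gx κ Φ t p O.merged) (KS.fT mk fx κ Φ t p O.merged)) : ℤ) * ((3 * (ℓL κ Φ t p O.merged (KS.gT mk gx κ Φ t p O.merged) (KS.fT mk fx κ Φ t p O.merged)) : ℕ) : ℤ) ≤ Λ₀)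
    (hΛQ1 : ((nL κ Φ t p O.merged (KS.gT mk gx κ Φ t p O.merged) (KS.fT mk fx κ Φ t p O.merged)) : ℤ) * ((3 * (ℓL κ Φ t p O.merged (KS.gT mk gx κ Φ t p O.merged) (KS.fT mk fx κ Φ t p O.merged)) : ℕ) : ℤ) ≤ Λ₁)
    (hΛZ : (|(prFA κ Φ t p O.merged (KS.gT mk gx κ Φ t p O.merged) (KS.fT mk fx κ Φ t p O.merged)).vβ| + |(prFA κ Φ t p O.merged (KS.gT mk gx κ Φ t p O.merged) (KS.fT mk fx κ Φ t p O.merged)).vα|) * ((Mu O.merged) : ℤ) ≤ Λ₀ ∧ (((nL κ Φ t p O.merged (KS.gT mk gx κ Φ t p O.merged) (KS.fT mk fx κ Φ t p O.merged)) : ℤ) + |(prFA κ Φ t p O.merged (KS.gT mk gx κ Φ t p O.merged) (KS.fT mk fx κ Φ t p O.merged)).h|) * ((Mu O.merged) : ℤ) ≤ Λ₁)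
    (hkA0 : (prFA κ Φ t p O.merged (KS.gT mk gx κ Φ t p O.merged) (KS.fT mk fx κ Φ t p O.merged)).c₀ * (|(prFA κ Φ t p O.merged (KS.gT mk gx κ Φ t p O.merged) (KS.fT mk fx κ Φ t p O.merged)).A| * Λ₀) ≤ (fun i : Fin 2 => if i = 0 then KS.kF₀A κ Φ t p O.merged cW mk (KS.gT mk gx κ Φ t p O.merged) (KS.fT mk fx κ Φ t p O.merged) else KS.kF₁A κ Φ t p O.merged cW mk (KS.gT mk gx κ Φ t p O.merged) (KS.fT mk fx κ Φ t p O.merged)) 0 * (prFA κ Φ t p O.merged (KS.gT mk gx κ Φ t p O.merged) (KS.fT mk fx κ Φ t p O.merged)).D)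
    (hkA1 : (prFA κ Φ t p O.merged (KS.gT mk gx κ Φ t p O.merged) (KS.fT mk fx κ Φ t p O.merged)).c₁ * (|(prFA κ Φ t p O.merged (KS.gT mk gx κ Φ t p O.merged) (KS.fT mk fx κ Φ t p O.merged)).A| * Λ₁) ≤ (fun i : Fin 2 => if i = 0 then KS.kF₀A κ Φ t p O.merged cW mk (KS.gT mk gx κ Φ t p O.merged) (KS.fT mk fx κ Φ t p O.merged) else KS.kF₁A κ Φ t p O.merged cW mk (KS.gT mk gx κ Φ t p O.merged) (KS.fT mk fx κ Φ t p O.merged)) 1 * (prFA κ Φ t p O.merged (KS.gT mk gx κ Φ t p O.merged) (KS.fT mk fx κ Φ t p O.merged)).D)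
    {kb : ℕ}
    (hkbMz : ((Mu O.merged) : ℤ) ≤ kb)
    (hπ1 : ((KS.BFs κ Φ t p O.merged cW mk (KS.gT mk gx κ Φ t p O.merged) (KS.fT mk fx κ Φ t p O.merged) 1).core1Lo 0).natAbs + ((KS.BFs κ Φ t p O.merged cW mk (KS.gT mk gx κ Φ t p O.merged) (KS.fT mk fx κ Φ t p O.merged) 1).core1Lo 1).natAbs ≤ r)
    (hclr₁ : (kb : ℤ) < (KS.BFs κ Φ t p O.merged cW mk (KS.gT mk gx κ Φ t p O.merged) (KS.fT mk fx κ Φ t p O.merged) 1).B₀lo 0 - (KS.BFs κ Φ t p O.merged cW mk (KS.gT mk gx κ Φ t p O.merged) (KS.fT mk fx κ Φ t p O.merged) 1).R' - (KS.BFs κ Φ t p O.merged cW mk (KS.gT mk gx κ Φ t p O.merged) (KS.fT mk fx κ Φ t p O.merged) 1).pr)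
    (nB : ℕ)
    -- the inner-chain fact UP TO THE LENGTH BUDGET `nF` (p3-g11 2026-08-22T02:23:54Z; the wrapper discharges it by `ChainFactF` at `n ≤ LfA K₀`)
    (hchain : ∀ (c : V) (Nr N₃ : ℕ), 0 + 1 + Nr + 1 + N₃ ≤ nB → ∀ (W : Sym2 V → unitInterval) (s : Fin (0 + 1 + Nr + 1 + N₃ + 1) → TStep (winGraph G c r))
      (T' : Fin (0 + 1 + Nr + 1 + N₃ + 1) → Finset V) (η' : ℝ),
      (∀ i, (s i).L.o = (s 0).L.o) →
      (∀ i : Fin (0 + 1 + Nr + 1 + N₃), T' (Fin.castSucc i) ⊆ (s i.succ).L.X 0) →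
      (∀ i, T' i ⊆ (s i).T) →
      (∀ i, (s i).KitsAtF W q Φ.Δ (Neg.δkit κ Φ)) →
      η' ≤ (Neg.δkit κ Φ) / 2 →
      (∀ i, (prodBernoulli W).real (⋃ t ∈ (s i).T \ T' i, openConn (s 0).L.o t) ≤ η') →
      1 - (Neg.δkit κ Φ) < (prodBernoulli W).real (s 0).L.reachB →
        1 - κ.δ₂ ^ 3 < (prodBernoulli W).real (⋃ t ∈ T' (Fin.last (0 + 1 + Nr + 1 + N₃)), openConn (s 0).L.o t))
    {Rb : ℕ}
    (hwideb : ∀ j, (KS0.j₀0 t O.merged mk) ≤ j → j ≤ (KS0.j₁0 κ Φ t p O.merged mk) → ∀ i, ((KS.BFs κ Φ t p O.merged cW mk (KS.gT mk gx κ Φ t p O.merged) (KS.fT mk fx κ Φ t p O.merged) 1).B₀lo - (j : Site 2)) i + 2 * tanOff (KS0.kit0 t O.merged mk ((((Mu O.merged)) : ℤ) + 2) (KS0.r₀0 t O.merged mk Rb)).ℓs (KS0.kit0 t O.merged mk ((((Mu O.merged)) : ℤ) + 2) (KS0.r₀0 t O.merged mk Rb)).M ≤ ((KS.BFs κ Φ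 t p O.merged cW mk (KS.gT mk gx κ Φ t p O.merged) (KS.fT mk fx κ Φ t p O.merged) 1).B₀hi + (j : Site 2)) i)
    (hdwb : ∀ j, (KS0.j₀0 t O.merged mk) ≤ j → j ≤ (KS0.j₁0 κ Φ t p O.merged mk) → ∀ i, ((KS.BFs κ Φ t p O.merged cW mk (KS.gT mk gx κ Φ t p O.merged) (KS.fT mk fx κ Φ t p O.merged) 1).B₀lo - (j : Site 2)) i + ((KS0.kit0 t O.merged mk ((((Mu O.merged)) : ℤ) + 2) (KS0.r₀0 t O.merged mk Rb)).d + 2 : ℕ) ≤ ((KS.BFs κ Φ t p O.merged cW mk (KS.gT mk gx κ Φ t p O.merged) (KS.fT mk fx κ Φ t p O.merged) 1).B₀hi + (j : Site 2)) i)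
    (hDwb : ∀ j, (KS0.j₀0 t O.merged mk) ≤ j → j ≤ (KS0.j₁0 κ Φ t p O.merged mk) → ∀ i, ((KS.BFs κ Φ t p O.merged cW mk (KS.gT mk gx κ Φ t p O.merged) (KS.fT mk fx κ Φ t p O.merged) 1).B₀lo - (j : Site 2)) i + ((shellD (KS0.kit0 t O.merged mk ((((Mu O.merged)) : ℤ) + 2) (KS0.r₀0 t O.merged mk Rb)) + 1 + (KS0.kit0 t O.merged mk ((((Mu O.merged)) : ℤ) + 2) (KS0.r₀0 t O.merged mk Rb)).d + (KS.KCmax t O.merged mk) + (KS.Rs t O.merged mk) : ℕ) : ℤ) ≤ ((KS.BFs κ Φ t p O.merged cW mk (KS.gT mk gx κ Φ t p O.merged) (KS.fT mk fx κ Φ t p O.merged) 1).B₀hi + (j : Site 2)) i)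
    (hRb₀ : (KS0.kit0 t O.merged mk ((((Mu O.merged)) : ℤ) + 2) (KS0.r₀0 t O.merged mk Rb)).r₀ ≤ r)
    (hEb : (KS0.j₁0 κ Φ t p O.merged mk) + ((KS0.kit0 t O.merged mk ((((Mu O.merged)) : ℤ) + 2) (KS0.r₀0 t O.merged mk Rb)).N * (tanOff (KS0.kit0 t O.merged mk ((((Mu O.merged)) : ℤ) + 2) (KS0.r₀0 t O.merged mk Rb)).ℓs (KS0.kit0 t O.merged mk ((((Mu O.merged)) : ℤ) + 2) (KS0.r₀0 t O.merged mk Rb)).M + 1) + (KS0.kit0 t O.merged mk ((((Mu O.merged)) : ℤ) + 2) (KS0.r₀0 t O.merged mk Rb)).N * (KS0.kit0 t O.merged mk ((((Mu O.merged)) : ℤ) + 2) (KS0.r₀0 t O.merged mk Rb)).d + (KS.KCmax t O.merged mk)) ≤ (KS.BFs κ Φ t p O.merged cW mk (KS.gT mk gx κ Φ t p O.merged) (KS.fT mk fx κ Φ t p O.merged) 1).R')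
    (hr₁R : Rb ≤ r)
    (hRr₀ : (KS0.kit0 t O.merged mk (((((Mu O.merged)) + 1 : ℕ) : ℤ) * ((shearUnit (nL κ Φ t p O.merged (KS.gT mk gx κ Φ t p O.merged) (KS.fT mk fx κ Φ t p O.merged)) (prFA κ Φ t p O.merged (KS.gT mk gx κ Φ t p O.merged) (KS.fT mk fx κ Φ t p O.merged)).h) : ℤ) + 1) (KS0.r₀0 t O.merged mk (RL κ Φ t p O (KS.gT mk gx) (KS.fT mk fx)))).r₀ ≤ r)
    (hr₂R : (RL κ Φ t p O (KS.gT mk gx) (KS.fT mk fx)) ≤ r)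
    -- the short region and the zone datum at the kit centres ((S0): inside `Rg`, connected, containing the centre and the fat-prism box `cylBallFin c kz Rk`)
    (hclrz : ((Mu O.merged) + 4) * ((nL κ Φ t p O.merged (KS.gT mk gx κ Φ t p O.merged) (KS.fT mk fx κ Φ t p O.merged)) + (prFA κ Φ t p O.merged (KS.gT mk gx κ Φ t p O.merged) (KS.fT mk fx κ Φ t p O.merged)).h.natAbs) ≤ (nL κ Φ t p O.merged (KS.gT mk gx κ Φ t p O.merged) (KS.fT mk fx κ Φ t p O.merged)) * ((ℓL κ Φ t p O.merged (KS.gT mk gx κ Φ t p O.merged) (KS.fT mk fx κ Φ t p O.merged)) + 1))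
    (hRsr : (KS.Rs t O.merged mk) ≤ r)
    (hρr : (Skelφ.fatRadius Φ.frame hC O.merged.k) ≤ r)
    (Qb Fb : V → Finset V)
    (hQb : ∀ c c', ∀ w ∈ Qb c', w ∈ graphBall G c' Rb ∧
      rootFrame (φL κ Φ t p O.D O.DT.toDataN O.ori (KS.gT mk gx κ Φ t p O.merged) (KS.fT mk fx κ Φ t p O.merged)) c 1 w ∈ Finset.Icc (rootFrame (φL κ Φ t p O.D O.DT.toDataN O.ori (KS.gT mk gx κ Φ t p O.merged) (KS.fT mk fx κ Φ t p O.merged)) c 1 c' - (((KS.BFs κ Φ t p O.merged cW mk (KS.gT mk gx κ Φ t p O.merged) (KS.fT mk fx κ Φ t p O.merged) 1).pr : ℕ) : Site 2)) (rootFrame (φL κ Φ t p O.D O.DT.toDataN O.ori (KS.gT mk gx κ Φ t p O.merged) (KS.fT mk fx κ Φ t p O.merged)) c 1 c' + (((KS.BFs κ Φ t p O.merged cW mk (KS.gT mk gx κ Φ t p O.merged) (KS.fT mk fx κ Φ t p O.merged) 1).pr : ℕ) : Site 2)))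
    (hFb : ∀ c c', ∀ w ∈ Fb c', w ∈ Qb c' ∧ rootFrame (φL κ Φ t p O.D O.DT.toDataN O.ori (KS.gT mk gx κ Φ t p O.merged) (KS.fT mk fx κ Φ t p O.merged)) c 1 w ∈ Finset.Icc (rootFrame (φL κ Φ t p O.D O.DT.toDataN O.ori (KS.gT mk gx κ Φ t p O.merged) (KS.fT mk fx κ Φ t p O.merged)) c 1 c' + (KS.BFs κ Φ t p O.merged cW mk (KS.gT mk gx κ Φ t p O.merged) (KS.fT mk fx κ Φ t p O.merged) 1).dlo) (rootFrame (φL κ Φ t p O.D O.DT.toDataN O.ori (KS.gT mk gx κ Φ t p O.merged) (KS.fT mk fx κ Φ t p O.merged)) c 1 c' + (KS.BFs κ Φ t p O.merged cW mk (KS.gT mk gx κ Φ t p O.merged) (KS.fT mk fx κ Φ t p O.merged) 1).dhi))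
    (hbridge : ∀ c', 1 - (Neg.δkit κ Φ) ^ 3 < (bondPercolation G q).real (linkIn (↑(Qb c') : Set V) (O.merged.Λ c' O.merged.k) (Fb c')))
    (hR₁b : ((SUS ex mx κ Φ t p O.merged (KS.gT mk gx κ Φ t p O.merged) (KS.fT mk fx κ Φ t p O.merged) q).Rex (Skelφ.fatRadius Φ.frame hC O.merged.k)) ≤ r - (KS0.kit0 t O.merged mk ((((Mu O.merged)) : ℤ) + 2) (KS0.r₀0 t O.merged mk Rb)).r₀)
    (hR₁r : ((SUS ex mx κ Φ t p O.merged (KS.gT mk gx κ Φ t p O.merged) (KS.fT mk fx κ Φ t p O.merged) q).Rex (Skelφ.fatRadius Φ.frame hC O.merged.k)) ≤ r - (KS0.kit0 t O.merged mk (((((Mu O.merged)) + 1 : ℕ) : ℤ) * ((shearUnit (nL κ Φ t p O.merged (KS.gT mk gx κ Φ t p O.merged) (KS.fT mk fx κ Φ t p O.merged)) (prFA κ Φ t p O.merged (KS.gT mk gx κ Φ t p O.merged) (KS.fT mk fx κ Φ t p O.merged)).h) : ℤ) + 1) (KS0.r₀0 t O.merged mk (RL κ Φ t p O (KS.gT mk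 gx) (KS.fT mk fx)))).r₀)
    -- the FACE KIT: constants, exit table rooms, reach, inputs at accuracy `κ.δ₂`
    (hr₀L : (KS0.kit0 t O.merged mk (((((Mu O.merged)) + 1 : ℕ) : ℤ) * (prFA κ Φ t p O.merged (KS.gT mk gx κ Φ t p O.merged) (KS.fT mk fx κ Φ t p O.merged)).D + 1) (KS0.r₀0 t O.merged mk r)).r₀ + 1 ≤ 2 * (Skelφ.Prm.Lp ((SUS ex mx) κ Φ t p O.merged (KS.gT mk gx κ Φ t p O.merged) (KS.fT mk fx κ Φ t p O.merged) q)))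
    -- THE PER-CENTRE NUMBERS (x-faces `du.1 = 0`, y′-faces `du.1 = 1`)
    -- the providers' stride counts within the budget
    -- ONE-SIDED ((R-44)(c)): the numbers' tangential sign is the served sign `1` (one-sided counts `KS.N3WX/N3WY`)
    -- (hp-8 g44) THE NUMBERS BATCH's OWN NODE ROWS: frame rooms at the contact offsets `kEX/kEY` (band `E := Rlev0 + reach0`), the zone bound read by
    -- the two lattice functionals, the one-sided glue rows (x / y′ with `v_L ≥ 0` / y′ with `v_L < 0`), the capacity, the reach budgets, the stride budget
    {kEX kEY : ℤ}
    (hroomX : ∀ du : MDir, du.1 = 0 →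
      (prFA κ Φ t p O.merged (KS.gT mk gx κ Φ t p O.merged) (KS.fT mk fx κ Φ t p O.merged)).Mabs * ((fun du : MDir => (((prFA κ Φ t p O.merged (KS.gT mk gx κ Φ t p O.merged) (KS.fT mk fx κ Φ t p O.merged)).awF₂V (fcellsV κ Φ t p O.merged (KS.gT mk gx κ Φ t p O.merged) (KS.fT mk fx κ Φ t p O.merged) (cOf κ Φ t p O (KS.gT mk gx) (KS.fT mk fx) cv) (hOf κ Φ t p O (KS.gT mk gx) (KS.fT mk fx) hv)) du).toNat)) du + (KS0.Rlev0 κ Φ t p O.merged mk + KS0.reach0 t O.merged mk)) + (prFA κ Φ t p O.merged (KS.gT mk gx κ Φ t p O.merged) (KS.fT mk fx κ Φ t p O.merged)).rdN du.1 ((prFA κ Φ t p O.merged (KS.gT mk gx κ Φ t p O.merged) (KS.fT mk fx κ Φ t p O.merged)).bOf du.1) * ((KS0.Rlev0 κ Φ t p O.merged mk + KS0.reach0 t O.merged mk) + 1) * (prFA κ Φ t p O.merged (KS.gT mk gx κ Φ t p O.merged) (KS.fT mk fx κ Φ t p O.merged)).D ≤ (prFA κ Φ t p O.merged (KS.gT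 mk gx κ Φ t p O.merged) (KS.fT mk fx κ Φ t p O.merged)).rdK du.1 ((prFA κ Φ t p O.merged (KS.gT mk gx κ Φ t p O.merged) (KS.fT mk fx κ Φ t p O.merged)).bOf du.1) * kEX * (prFA κ Φ t p O.merged (KS.gT mk gx κ Φ t p O.merged) (KS.fT mk fx κ Φ t p O.merged)).D)
    (hroomY : ∀ du : MDir, du.1 = 1 →
      (prFA κ Φ t p O.merged (KS.gT mk gx κ Φ t p O.merged) (KS.fT mk fx κ Φ t p O.merged)).Mabs * ((fun du : MDir => (((prFA κ Φ t p O.merged (KS.gT mk gx κ Φ t p O.merged) (KS.fT mk fx κ Φ t p O.merged)).awF₂V (fcellsV κ Φ t p O.merged (KS.gT mk gx κ Φ t p O.merged) (KS.fT mk fx κ Φ t p O.merged) (cOf κ Φ t p O (KS.gT mk gx) (KS.fT mk fx) cv) (hOf κ Φ t p O (KS.gT mk gx) (KS.fT mk fx) hv)) du).toNat)) du + (KS0.Rlev0 κ Φ t p O.merged mk + KS0.reach0 t O.merged mk)) + (prFA κ Φ t p O.merged (KS.gT mk gx κ Φ t p O.merged) (KS.fT mk fx κ Φ t p O.merged)).rdN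 du.1 ((prFA κ Φ t p O.merged (KS.gT mk gx κ Φ t p O.merged) (KS.fT mk fx κ Φ t p O.merged)).bOf du.1) * ((KS0.Rlev0 κ Φ t p O.merged mk + KS0.reach0 t O.merged mk) + 1) * (prFA κ Φ t p O.merged (KS.gT mk gx κ Φ t p O.merged) (KS.fT mk fx κ Φ t p O.merged)).D ≤ (prFA κ Φ t p O.merged (KS.gT mk gx κ Φ t p O.merged) (KS.fT mk fx κ Φ t p O.merged)).rdK du.1 ((prFA κ Φ t p O.merged (KS.gT mk gx κ Φ t p O.merged) (KS.fT mk fx κ Φ t p O.merged)).bOf du.1) * kEY * (prFA κ Φ t p O.merged (KS.gT mk gx κ Φ t p O.merged) (KS.fT mk fx κ Φ t p O.merged)).D)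
    (hZk : ∀ (c' : V) (du : MDir), ∀ v ∈ O.merged.Λ c' (Mu O.merged), |(prFA κ Φ t p O.merged (KS.gT mk gx κ Φ t p O.merged) (KS.fT mk fx κ Φ t p O.merged)).ψ (φL κ Φ t p O.D O.DT.toDataN O.ori (KS.gT mk gx κ Φ t p O.merged) (KS.fT mk fx κ Φ t p O.merged)) c' v du.1| ≤ (fun i : Fin 2 => if i = 0 then KS.kF₀A κ Φ t p O.merged cW mk (KS.gT mk gx κ Φ t p O.merged) (KS.fT mk fx κ Φ t p O.merged) else KS.kF₁A κ Φ t p O.merged cW mk (KS.gT mk gx κ Φ t p O.merged) (KS.fT mk fx κ Φ t p O.merged)) du.1)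
    (hkEr : kEX + ((fcellsV κ Φ t p O.merged (KS.gT mk gx κ Φ t p O.merged) (KS.fT mk fx κ Φ t p O.merged) (cOf κ Φ t p O (KS.gT mk gx) (KS.fT mk fx) cv) (hOf κ Φ t p O (KS.gT mk gx) (KS.fT mk fx) hv)).r 1 : ℤ) ≤ 5 * ((fcellsV κ Φ t p O.merged (KS.gT mk gx κ Φ t p O.merged) (KS.fT mk fx κ Φ t p O.merged) (cOf κ Φ t p O (KS.gT mk gx) (KS.fT mk fx) cv) (hOf κ Φ t p O (KS.gT mk gx) (KS.fT mk fx) hv)).r 1 : ℤ))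
    (hkE2 : 2 * (kEX + ((fcellsV κ Φ t p O.merged (KS.gT mk gx κ Φ t p O.merged) (KS.fT mk fx κ Φ t p O.merged) (cOf κ Φ t p O (KS.gT mk gx) (KS.fT mk fx) cv) (hOf κ Φ t p O (KS.gT mk gx) (KS.fT mk fx) hv)).r 1 : ℤ)) + 8 * KS.u₁A κ Φ t p O.merged (KS.gT mk gx κ Φ t p O.merged) (KS.fT mk fx κ Φ t p O.merged) + 8 + 2 * ((fcellsV κ Φ t p O.merged (KS.gT mk gx κ Φ t p O.merged) (KS.fT mk fx κ Φ t p O.merged) (cOf κ Φ t p O (KS.gT mk gx) (KS.fT mk fx) cv) (hOf κ Φ t p O (KS.gT mk gx) (KS.fT mk fx) hv)).c 0 : ℤ) ≤ 5 * ((fcellsV κ Φ t p O.merged (KS.gT mk gx κ Φ t p O.merged) (KS.fT mk fx κ Φ t p O.merged) (cOf κ Φ t p O (KS.gT mk gx) (KS.fT mk fx) cv) (hOf κ Φ t p O (KS.gT mk gx) (KS.fT mk fx) hv)).r 1 : ℤ))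
    (hfwdX : 2 * kEX + ((fcellsV κ Φ t p O.merged (KS.gT mk gx κ Φ t p O.merged) (KS.fT mk fx κ Φ t p O.merged) (cOf κ Φ t p O (KS.gT mk gx) (KS.fT mk fx) cv) (hOf κ Φ t p O (KS.gT mk gx) (KS.fT mk fx) hv)).hF 0 : ℤ) - (fcellsV κ Φ t p O.merged (KS.gT mk gx κ Φ t p O.merged) (KS.fT mk fx κ Φ t p O.merged) (cOf κ Φ t p O (KS.gT mk gx) (KS.fT mk fx) cv) (hOf κ Φ t p O (KS.gT mk gx) (KS.fT mk fx) hv)).hB 0 + 6 * KS.u₁A κ Φ t p O.merged (KS.gT mk gx κ Φ t p O.merged) (KS.fT mk fx κ Φ t p O.merged) ≤ 2 * (((fcellsV κ Φ t p O.merged (KS.gT mk gx κ Φ t p O.merged) (KS.fT mk fx κ Φ t p O.merged) (cOf κ Φ t p O (KS.gT mk gx) (KS.fT mk fx) cv) (hOf κ Φ t p O (KS.gT mk gx) (KS.fT mk fx) hv)).c 0 : ℤ) + (KS.bwX κ Φ t p O.merged (KS.gT mk gx κ Φ t p O.merged) (KS.fT mk fx κ Φ t p O.merged))))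
    (hkE : kEY + ((fcellsV κ Φ t p O.merged (KS.gT mk gx κ Φ t p O.merged) (KS.fT mk fx κ Φ t p O.merged) (cOf κ Φ t p O (KS.gT mk gx) (KS.fT mk fx) cv) (hOf κ Φ t p O (KS.gT mk gx) (KS.fT mk fx) hv)).r 0 : ℤ) ≤ 5 * ((fcellsV κ Φ t p O.merged (KS.gT mk gx κ Φ t p O.merged) (KS.fT mk fx κ Φ t p O.merged) (cOf κ Φ t p O (KS.gT mk gx) (KS.fT mk fx) cv) (hOf κ Φ t p O (KS.gT mk gx) (KS.fT mk fx) hv)).r 0 : ℤ))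
    (hkE8 : kEY + ((fcellsV κ Φ t p O.merged (KS.gT mk gx κ Φ t p O.merged) (KS.fT mk fx κ Φ t p O.merged) (cOf κ Φ t p O (KS.gT mk gx) (KS.fT mk fx) cv) (hOf κ Φ t p O (KS.gT mk gx) (KS.fT mk fx) hv)).r 0 : ℤ) + 8 * KS.u₀A κ Φ t p O.merged (KS.gT mk gx κ Φ t p O.merged) (KS.fT mk fx κ Φ t p O.merged) + 8 + (fcellsV κ Φ t p O.merged (KS.gT mk gx κ Φ t p O.merged) (KS.fT mk fx κ Φ t p O.merged) (cOf κ Φ t p O (KS.gT mk gx) (KS.fT mk fx) cv) (hOf κ Φ t p O (KS.gT mk gx) (KS.fT mk fx) hv)).c 1 ≤ 5 * ((fcellsV κ Φ t p O.merged (KS.gT mk gx κ Φ t p O.merged) (KS.fT mk fx κ Φ t p O.merged) (cOf κ Φ t p O (KS.gT mk gx) (KS.fT mk fx) cv) (hOf κ Φ t p O (KS.gT mk gx) (KS.fT mk fx) hv)).r 0 : ℤ))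
    (hkE24 : 2 * (kEY + ((fcellsV κ Φ t p O.merged (KS.gT mk gx κ Φ t p O.merged) (KS.fT mk fx κ Φ t p O.merged) (cOf κ Φ t p O (KS.gT mk gx) (KS.fT mk fx) cv) (hOf κ Φ t p O (KS.gT mk gx) (KS.fT mk fx) hv)).r 0 : ℤ)) + 24 * KS.u₀A κ Φ t p O.merged (KS.gT mk gx κ Φ t p O.merged) (KS.fT mk fx κ Φ t p O.merged) + 24 + 2 * ((fcellsV κ Φ t p O.merged (KS.gT mk gx κ Φ t p O.merged) (KS.fT mk fx κ Φ t p O.merged) (cOf κ Φ t p O (KS.gT mk gx) (KS.fT mk fx) cv) (hOf κ Φ t p O (KS.gT mk gx) (KS.fT mk fx) hv)).c 1 : ℤ) ≤ 5 * ((fcellsV κ Φ t p O.merged (KS.gT mk gx κ Φ t p O.merged) (KS.fT mk fx κ Φ t p O.merged) (cOf κ Φ t p O (KS.gT mk gx) (KS.fT mk fx) cv) (hOf κ Φ t p O (KS.gT mk gx) (KS.fT mk fx) hv)).r 0 : ℤ))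
    (hfwdY : 2 * kEY + ((fcellsV κ Φ t p O.merged (KS.gT mk gx κ Φ t p O.merged) (KS.fT mk fx κ Φ t p O.merged) (cOf κ Φ t p O (KS.gT mk gx) (KS.fT mk fx) cv) (hOf κ Φ t p O (KS.gT mk gx) (KS.fT mk fx) hv)).hF 1 : ℤ) - (fcellsV κ Φ t p O.merged (KS.gT mk gx κ Φ t p O.merged) (KS.fT mk fx κ Φ t p O.merged) (cOf κ Φ t p O (KS.gT mk gx) (KS.fT mk fx) cv) (hOf κ Φ t p O (KS.gT mk gx) (KS.fT mk fx) hv)).hB 1 + 14 * KS.u₀A κ Φ t p O.merged (KS.gT mk gx κ Φ t p O.merged) (KS.fT mk fx κ Φ t p O.merged) ≤ 2 * (((fcellsV κ Φ t p O.merged (KS.gT mk gx κ Φ t p O.merged) (KS.fT mk fx κ Φ t p O.merged) (cOf κ Φ t p O (KS.gT mk gx) (KS.fT mk fx) cv) (hOf κ Φ t p O (KS.gT mk gx) (KS.fT mk fx) hv)).c 1 : ℤ) + (KS.bwY κ Φ t p O.merged (KS.gT mk gx κ Φ t p O.merged) (KS.fT mk fx κ Φ t p O.merged))))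
    (hfwdYx : 2 * kEY + ((fcellsV κ Φ t p O.merged (KS.gT mk gx κ Φ t p O.merged) (KS.fT mk fx κ Φ t p O.merged) (cOf κ Φ t p O (KS.gT mk gx) (KS.fT mk fx) cv) (hOf κ Φ t p O (KS.gT mk gx) (KS.fT mk fx) hv)).hF 1 : ℤ) - (fcellsV κ Φ t p O.merged (KS.gT mk gx κ Φ t p O.merged) (KS.fT mk fx κ Φ t p O.merged) (cOf κ Φ t p O (KS.gT mk gx) (KS.fT mk fx) cv) (hOf κ Φ t p O (KS.gT mk gx) (KS.fT mk fx) hv)).hB 1 + 24 * KS.u₀A κ Φ t p O.merged (KS.gT mk gx κ Φ t p O.merged) (KS.fT mk fx κ Φ t p O.merged) + 10 ≤ 2 * (((fcellsV κ Φ t p O.merged (KS.gT mk gx κ Φ t p O.merged) (KS.fT mk fx κ Φ t p O.merged) (cOf κ Φ t p O (KS.gT mk gx) (KS.fT mk fx) cv) (hOf κ Φ t p O (KS.gT mk gx) (KS.fT mk fx) hv)).c 1 : ℤ) + (KS.bwY κ Φ t p O.merged (KS.gT mk gx κ Φ t p O.merged) (KS.fT mk fx κ Φ t p O.merged))))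
    (hc600 : 600 * Neg.Kq κ ≤ cW)
    (hrX : KS.πBudX κ Φ t p O.merged cW mk (KS.gT mk gx κ Φ t p O.merged) (KS.fT mk fx κ Φ t p O.merged) ≤ r)
    (hrY : KS.πBudY κ Φ t p O.merged cW mk (KS.gT mk gx κ Φ t p O.merged) (KS.fT mk fx κ Φ t p O.merged) ≤ r)
    (hnB840 : 840 * Neg.Kq κ + 10 ≤ nB) :
    Skelφ.FaceOblRMOF G ((choiceAtQ3V κ Φ t p Pv (KS.gT mk gx) (KS.fT mk fx) (SUS ex mx) cv hv BSlot.small3 hC).scheme O q)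
      ((choiceAtQ3V κ Φ t p Pv (KS.gT mk gx) (KS.fT mk fx) (SUS ex mx) cv hv BSlot.small3 hC).FD O q) Φ.Δ κ.δ₂ := by
  have hAt3 := atQ3_of_atQ3V hAt
  have hAtT := atQ3T_of_atQ3 hAt3
  have hNL : EqNumL κ Φ t p O.merged (KS.gT mk gx κ Φ t p O.merged) (KS.fT mk fx κ Φ t p O.merged) := eqNumL_of_atQT hAtT
  have hκ10 : (hL κ Φ t p O.merged (KS.gT mk gx κ Φ t p O.merged) (KS.fT mk fx κ Φ t p O.merged)).natAbs ≤ 10 * nL κ Φ t p O.merged (KS.gT mk gx κ Φ t p O.merged) (KS.fT mk fx κ Φ t p O.merged) := (clauseL_of_atQT hAtT).2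
  obtain ⟨-, hq1, hq2, hCq⟩ := factsNS_of_atQT hAtT
  obtain ⟨hnL1, hℓL1⟩ := one_le_of_eqNumL κ Φ t p O.merged (KS.gT mk gx κ Φ t p O.merged) (KS.fT mk fx κ Φ t p O.merged) hNL
  obtain ⟨hc₀, hc₁⟩ := prFA_c_pos κ Φ t p O.merged (KS.gT mk gx κ Φ t p O.merged) (KS.fT mk fx κ Φ t p O.merged)
  have hDv : 0 < (prFA κ Φ t p O.merged (KS.gT mk gx κ Φ t p O.merged) (KS.fT mk fx κ Φ t p O.merged)).D := prFA_D_pos κ Φ t p O.merged (KS.gT mk gx κ Φ t p O.merged) (KS.fT mk fx κ Φ t p O.merged) hNL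
  have hDd := prFA_D κ Φ t p O.merged (KS.gT mk gx κ Φ t p O.merged) (KS.fT mk fx κ Φ t p O.merged)
  have hPC : (fcellsV κ Φ t p O.merged (KS.gT mk gx κ Φ t p O.merged) (KS.fT mk fx κ Φ t p O.merged) (cOf κ Φ t p O (KS.gT mk gx) (KS.fT mk fx) cv) (hOf κ Φ t p O (KS.gT mk gx) (KS.fT mk fx) hv)).toPCells2 = fcellsA κ Φ t p O.merged (KS.gT mk gx κ Φ t p O.merged) (KS.fT mk fx κ Φ t p O.merged) := fcellsV_toPCells2 ..
  obtain ⟨-, -, -, -, -, hMLR, -, -⟩ := KS.slotsF_hyps κ Φ t p O.merged cW mk gx fx hgx hfx hNL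
  have hb : (bOf κ Φ t p O (KS.gT mk gx) (KS.fT mk fx) BSlot.small3) = (BSlot.small3 κ Φ t p O.merged (KS.gT mk gx κ Φ t p O.merged) (KS.fT mk fx κ Φ t p O.merged)) := by
    funext i; show min _ _ = _; exact min_eq_left (small3_le κ Φ t p O.merged (KS.gT mk gx κ Φ t p O.merged) (KS.fT mk fx κ Φ t p O.merged) i)
  have hb1v : ∀ i, 1 ≤ (bOf κ Φ t p O (KS.gT mk gx) (KS.fT mk fx) BSlot.small3) i := fun i => by rw [hb]; exact small3_pos κ Φ t p O.merged (KS.gT mk gx κ Φ t p O.merged) (KS.fT mk fx κ Φ t p O.merged) i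
  -- levels / counts of the (S0) kits (stmt's KS0 API; p3-g18's QCKV idioms)
  have hT0pos : 1 ≤ KS0.T0 t O.merged mk := by
    have h := (KS0.kit0_ok t O.merged mk ((((Mu O.merged)) : ℤ) + 2) (KS0.r₀0 t O.merged mk Rb) (kq := 0) (by norm_num)).2.2.2.1; unfold KS0.T0 KS0.M0; omega
  obtain ⟨hkF2, hcountF⟩ := KS0.counts_atq_face κ Φ t p O.merged mk hp0 hp1 hq1 hq2
  have hcnt := KS0.counts_atq κ Φ t p O.merged mk hp0 hp1 hq1 hq2 (le_refl (Neg.δkit κ Φ))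
  have hNk := KS0.hNk0_at κ Φ t p O.merged mk hp0 hp1
  have hcountv : 1 / (1 - (q : ℝ)) ^ (Φ.Δ * (KS0.Nk0 κ Φ t p O.merged mk)) ≤ κ.δ₂ * ((Finset.Icc ((KS0.j₀0 t O.merged mk - 1) + 1) (KS0.Rlev0 κ Φ t p O.merged mk)).card : ℝ) := by
    refine hcountF.trans (mul_le_mul_of_nonneg_left ?_ κ.hδ₂0.le)
    have hsub : Finset.Icc (KS0.j₀0 t O.merged mk) (KS0.j₁0 κ Φ t p O.merged mk) ⊆ Finset.Icc ((KS0.j₀0 t O.merged mk - 1) + 1) (KS0.Rlev0 κ Φ t p O.merged mk) :=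
      Finset.Icc_subset_Icc (by unfold KS0.j₀0; omega) (KS0.R'0_eq κ Φ t p O.merged mk).2.2
    exact_mod_cast Finset.card_le_card hsub
  have hreach0 : ∀ (A : ℤ) (r₀ : ℕ), (KS0.j₁0 κ Φ t p O.merged mk) +
      ((KS0.kit0 t O.merged mk A r₀).N * (tanOff (KS0.kit0 t O.merged mk A r₀).ℓs (KS0.kit0 t O.merged mk A r₀).M + 1) +
        (KS0.kit0 t O.merged mk A r₀).N * (KS0.kit0 t O.merged mk A r₀).d + KS.KCmax t O.merged mk) ≤ (KS0.R'0 κ Φ t p O.merged mk) := by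
    intro A r₀
    rw [KS0.tanOff_kit0]
    simp only [KS0.kit0]
    have h := (KS0.R'0_eq κ Φ t p O.merged mk).1
    unfold KS0.reach0 at h
    omega
  have hreachE : (KS0.Rlev0 κ Φ t p O.merged mk) + ((KS0.kit0 t O.merged mk (((((Mu O.merged)) + 1 : ℕ) : ℤ) * (prFA κ Φ t p O.merged (KS.gT mk gx κ Φ t p O.merged) (KS.fT mk fx κ Φ t p O.merged)).D + 1) (KS0.r₀0 t O.merged mk r)).N * (tanOff (KS0.kit0 t O.merged mk (((((Mu O.merged)) + 1 : ℕ) : ℤ) * (prFA κ Φ t p O.merged (KS.gT mk gx κ Φ t p O.merged) (KS.fT mk fx κ Φ t p O.merged)).D + 1) (KS0.r₀0 t O.merged mk r)).ℓs (KS0.kit0 t O.merged mk (((((Mu O.merged)) + 1 : ℕ) : ℤ) * (prFA κ Φ t p O.merged (KS.gT mk gx κ Φ t p O.merged) (KS.fT mk fx κ Φ t p O.merged)).D + 1) (KS0.r₀0 t O.merged mk r)).M + 1) + (KS0.kit0 t O.merged mk (((((Mu O.merged)) + 1 : ℕ) : ℤ) * (prFA κ Φ t p O.merged (KS.gT mk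 gx κ Φ t p O.merged) (KS.fT mk fx κ Φ t p O.merged)).D + 1) (KS0.r₀0 t O.merged mk r)).N * (KS0.kit0 t O.merged mk (((((Mu O.merged)) + 1 : ℕ) : ℤ) * (prFA κ Φ t p O.merged (KS.gT mk gx κ Φ t p O.merged) (KS.fT mk fx κ Φ t p O.merged)).D + 1) (KS0.r₀0 t O.merged mk r)).d + KS.KCmax t O.merged mk) ≤ (KS0.Rlev0 κ Φ t p O.merged mk + KS0.reach0 t O.merged mk) := by
    rw [KS0.tanOff_kit0]
    simp only [KS0.kit0]
    unfold KS0.reach0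
    omega
  have hwA : ∀ (A : ℤ) (r₀ : ℕ), 2 * ((tanOff (KS0.kit0 t O.merged mk A r₀).ℓs (KS0.kit0 t O.merged mk A r₀).M : ℕ) : ℤ) ≤ 2 * (((KS0.j₀0 t O.merged mk) : ℕ) : ℤ) := fun A r₀ => by
    rw [KS0.tanOff_kit0]; unfold KS0.j₀0; exact le_rfl
  have hwD : ∀ (A : ℤ) (r₀ : ℕ), (((KS0.kit0 t O.merged mk A r₀).d + 2 : ℕ) : ℤ) ≤ 2 * (((KS0.j₀0 t O.merged mk) : ℕ) : ℤ) := fun A r₀ => by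
    have h := (KS0.levels_wide t O.merged mk (le_refl (KS0.j₀0 t O.merged mk))).2.1
    rw [(KS0.kit0_fields t O.merged mk A r₀).2.2.2.1]; unfold KS0.j₀0 at *; push_cast; omega
  have hwDD : ∀ (A : ℤ) (r₀ : ℕ), ((Skelφ.shellD (KS0.kit0 t O.merged mk A r₀) + 1 + (KS0.kit0 t O.merged mk A r₀).d + (KS.KCmax t O.merged mk) + (KS.Rs t O.merged mk) : ℕ) : ℤ) ≤ 2 * (((KS0.j₀0 t O.merged mk) : ℕ) : ℤ) := fun A r₀ => by
    have h := (KS0.levels_wide t O.merged mk (le_refl (KS0.j₀0 t O.merged mk))).2.2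
    rw [KS0.shellD_kit0, (KS0.kit0_fields t O.merged mk A r₀).2.2.2.1]; unfold KS0.j₀0 at *; push_cast; omega
  have hMtanv : ((tanOff (KS0.kit0 t O.merged mk (((((Mu O.merged)) + 1 : ℕ) : ℤ) * (prFA κ Φ t p O.merged (KS.gT mk gx κ Φ t p O.merged) (KS.fT mk fx κ Φ t p O.merged)).D + 1) (KS0.r₀0 t O.merged mk r)).ℓs (KS0.kit0 t O.merged mk (((((Mu O.merged)) + 1 : ℕ) : ℤ) * (prFA κ Φ t p O.merged (KS.gT mk gx κ Φ t p O.merged) (KS.fT mk fx κ Φ t p O.merged)).D + 1) (KS0.r₀0 t O.merged mk r)).M : ℕ) : ℤ) ≤ (((KS0.j₀0 t O.merged mk - 1) : ℕ) : ℤ) + 1 := by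
    rw [KS0.tanOff_kit0]; unfold KS0.j₀0; have := hT0pos; omega
  have hMdv : (KS0.kit0 t O.merged mk (((((Mu O.merged)) + 1 : ℕ) : ℤ) * (prFA κ Φ t p O.merged (KS.gT mk gx κ Φ t p O.merged) (KS.fT mk fx κ Φ t p O.merged)).D + 1) (KS0.r₀0 t O.merged mk r)).d + 2 ≤ 2 * (KS0.j₀0 t O.merged mk - 1) + 2 := by
    have h := (KS0.levels_wide t O.merged mk (le_refl (KS0.j₀0 t O.merged mk))).2.1
    rw [(KS0.kit0_fields t O.merged mk _ _).2.2.2.1]; unfold KS0.j₀0 at *; have := hT0pos; omega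
  have hMDv : Skelφ.shellD (KS0.kit0 t O.merged mk (((((Mu O.merged)) + 1 : ℕ) : ℤ) * (prFA κ Φ t p O.merged (KS.gT mk gx κ Φ t p O.merged) (KS.fT mk fx κ Φ t p O.merged)).D + 1) (KS0.r₀0 t O.merged mk r)) + 1 + (KS0.kit0 t O.merged mk (((((Mu O.merged)) + 1 : ℕ) : ℤ) * (prFA κ Φ t p O.merged (KS.gT mk gx κ Φ t p O.merged) (KS.fT mk fx κ Φ t p O.merged)).D + 1) (KS0.r₀0 t O.merged mk r)).d + (KS.KCmax t O.merged mk) + (KS.Rs t O.merged mk) ≤ 2 * (KS0.j₀0 t O.merged mk - 1) + 2 := by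
    have h := (KS0.levels_wide t O.merged mk (le_refl (KS0.j₀0 t O.merged mk))).2.2
    rw [KS0.shellD_kit0, (KS0.kit0_fields t O.merged mk _ _).2.2.2.1]; unfold KS0.j₀0 at *; have := hT0pos; omega
  have hKCb : Skelφ.shellD (KS0.kit0 t O.merged mk ((((Mu O.merged)) : ℤ) + 2) (KS0.r₀0 t O.merged mk Rb)) + (Mu O.merged) + 1 ≤ (KS.KCmax t O.merged mk) := by simpa using (KS0.kit0_ok t O.merged mk ((((Mu O.merged)) : ℤ) + 2) (KS0.r₀0 t O.merged mk Rb) (kq := 0) (by norm_num)).2.2.2.1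
  -- run boxes are boxes
  have hcoreX : ∀ (R' q' N' k : ℕ), k ≤ N' → (xRunSched (nL κ Φ t p O.merged (KS.gT mk gx κ Φ t p O.merged) (KS.fT mk fx κ Φ t p O.merged)) (ℓL κ Φ t p O.merged (KS.gT mk gx κ Φ t p O.merged) (KS.fT mk fx κ Φ t p O.merged)) (prFA κ Φ t p O.merged (KS.gT mk gx κ Φ t p O.merged) (KS.fT mk fx κ Φ t p O.merged)).h R' q' N').lo k ≤ (xRunSched (nL κ Φ t p O.merged (KS.gT mk gx κ Φ t p O.merged) (KS.fT mk fx κ Φ t p O.merged)) (ℓL κ Φ t p O.merged (KS.gT mk gx κ Φ t p O.merged) (KS.fT mk fx κ Φ t p O.merged)) (prFA κ Φ t p O.merged (KS.gT mk gx κ Φ t p O.merged) (KS.fT mk fx κ Φ t p O.merged)).h R' q' N').hi k :=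
    fun R' q' N' k hk => Finset.nonempty_Icc.1 ((xRunSched (nL κ Φ t p O.merged (KS.gT mk gx κ Φ t p O.merged) (KS.fT mk fx κ Φ t p O.merged)) (ℓL κ Φ t p O.merged (KS.gT mk gx κ Φ t p O.merged) (KS.fT mk fx κ Φ t p O.merged)) (prFA κ Φ t p O.merged (KS.gT mk gx κ Φ t p O.merged) (KS.fT mk fx κ Φ t p O.merged)).h R' q' N').nonempty k (by change k ≤ N' + 1; omega))
  have hcoreY : ∀ (R' q' N' k : ℕ), k ≤ N' → (yRunSched hnL hvL hlay R' q' N').lo k ≤ (yRunSched hnL hvL hlay R' q' N').hi k :=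
    fun R' q' N' k hk => Finset.nonempty_Icc.1 ((yRunSched hnL hvL hlay R' q' N').nonempty k (by change k ≤ N' + 1; omega))
  -- the rim-excess device at the face diameter `m := mRS mx` and the face room `hdiam`
  have hη2 : (Neg.η κ Φ) ≤ κ.δ / 2 := le_trans (Neg.η_pos κ Φ).2.1 (by linarith [Neg.δkit_le_δ κ Φ])
  have hR1v := hR₁_US_η κ Φ t p O.merged (KS.gT mk gx κ Φ t p O.merged) (KS.fT mk fx κ Φ t p O.merged) ex mx q hCq (oL κ Φ t p O.D O.DT.toDataN O.ori (KS.gT mk gx κ Φ t p O.merged) (KS.fT mk fx κ Φ t p O.merged)) t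
  have hM := (prFA κ Φ t p O.merged (KS.gT mk gx κ Φ t p O.merged) (KS.fT mk fx κ Φ t p O.merged)).Mabs_pos hc₀ hc₁ hDd hDv
  have hmF : (prFA κ Φ t p O.merged (KS.gT mk gx κ Φ t p O.merged) (KS.fT mk fx κ Φ t p O.merged)).mF (fcellsA κ Φ t p O.merged (KS.gT mk gx κ Φ t p O.merged) (KS.fT mk fx κ Φ t p O.merged)) ≤ (((mRS κ Φ t p O.merged (KS.gT mk gx κ Φ t p O.merged) (KS.fT mk fx κ Φ t p O.merged) (mx κ Φ t p O.merged (KS.gT mk gx κ Φ t p O.merged) (KS.fT mk fx κ Φ t p O.merged))) : ℕ) : ℤ) := hmx.trans (by exact_mod_cast le_max_right _ _)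
  have hdiamv : ∀ b' : Fin 2, ((prFA κ Φ t p O.merged (KS.gT mk gx κ Φ t p O.merged) (KS.fT mk fx κ Φ t p O.merged)).rdK 1 b' + (prFA κ Φ t p O.merged (KS.gT mk gx κ Φ t p O.merged) (KS.fT mk fx κ Φ t p O.merged)).rdK 0 b') * ((50 * (fcellsV κ Φ t p O.merged (KS.gT mk gx κ Φ t p O.merged) (KS.fT mk fx κ Φ t p O.merged) (cOf κ Φ t p O (KS.gT mk gx) (KS.fT mk fx) cv) (hOf κ Φ t p O (KS.gT mk gx) (KS.fT mk fx) hv)).rmax : ℕ) + 1) * (prFA κ Φ t p O.merged (KS.gT mk gx κ Φ t p O.merged) (KS.fT mk fx κ Φ t p O.merged)).D ≤ (prFA κ Φ t p O.merged (KS.gT mk gx κ Φ t p O.merged) (KS.fT mk fx κ Φ t p O.merged)).Mabs * ((((mRS κ Φ t p O.merged (KS.gT mk gx κ Φ t p O.merged) (KS.fT mk fx κ Φ t p O.merged) (mx κ Φ t p O.merged (KS.gT mk gx κ Φ t p O.merged) (KS.fT mk fx κ Φ t p O.merged))) : ℕ) : ℤ) + 1) := fun b' =>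
    le_trans ((prFA κ Φ t p O.merged (KS.gT mk gx κ Φ t p O.merged) (KS.fT mk fx κ Φ t p O.merged)).hdiam_mF hc₀ hc₁ hDd hDv (fcellsA κ Φ t p O.merged (KS.gT mk gx κ Φ t p O.merged) (KS.fT mk fx κ Φ t p O.merged)) b') (mul_le_mul_of_nonneg_left (by linarith) hM.le)
  -- the zone at the seed level `k` ((R-42), p3-g17's ZoneK): inside the kit region, in the box `Mu`, fat-prism inclusion for the long links
  have hkMu := hk_of_atQ hAt3
  have hΛv : ∀ c', ∀ v ∈ O.merged.Λ c' O.merged.k, v ∈ (KS.RgK G t O.merged mk (KS.φK Φ t O.D O.DT.toDataN O.ori mk)) c' ∧ (φL κ Φ t p O.D O.DT.toDataN O.ori (KS.gT mk gx κ Φ t p O.merged) (KS.fT mk fx κ Φ t p O.merged)) v - (φL κ Φ t p O.D O.DT.toDataN O.ori (KS.gT mk gx κ Φ t p O.merged) (KS.fT mk fx κ Φ t p O.merged)) c' ∈ box 2 (Mu O.merged) := fun c' v hv => by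
    refine ⟨hΛRgK_of_atQ mk hAt3 c' hv, ?_⟩
    have h := (Skelφ.mem_cyl (φL κ Φ t p O.D O.DT.toDataN O.ori (KS.gT mk gx κ Φ t p O.merged) (KS.fT mk fx κ Φ t p O.merged)) c' O.merged.k v).1 (zoneK_subset_cyl_φL hAt3 c' (Finset.mem_coe.2 hv))
    rw [mem_box] at h ⊢
    intro i; have := h i; have := hkMu.2; push_cast at *; omega
  have hZUv : ∀ c, O.merged.Λ c O.merged.k ⊆ pgramPrismFin G (φL κ Φ t p O.D O.DT.toDataN O.ori (KS.gT mk gx κ Φ t p O.merged) (KS.fT mk fx κ Φ t p O.merged)) c (nL κ Φ t p O.merged (KS.gT mk gx κ Φ t p O.merged) (KS.fT mk fx κ Φ t p O.merged)) (prFA κ Φ t p O.merged (KS.gT mk gx κ Φ t p O.merged) (KS.fT mk fx κ Φ t p O.merged)).h (3 * (ℓL κ Φ t p O.merged (KS.gT mk gx κ Φ t p O.merged) (KS.fT mk fx κ Φ t p O.merged))) (RL κ Φ t p O (KS.gT mk gx) (KS.fT mk fx)) := by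
    intro c
    obtain ⟨-, -, -, hReq, -⟩ := Skelφ.StepI.OutO.FactsO.seed hAt3.1.factsO
    rw [zoneK_eq_fatSeq hAt3 c]
    have hReach : KS0.reach0 t O.merged mk < (KS0.R'0 κ Φ t p O.merged mk) := (KS0.T0_lt_R'0 κ Φ t p O.merged mk).2.2.1
    have hKC : (Mu O.merged) + 1 ≤ KS.KCmax t O.merged mk := by
      have h := (KS0.kit0_ok t O.merged mk ((((Mu O.merged)) : ℤ) + 2) (KS0.r₀0 t O.merged mk Rb) (kq := 0) (by norm_num)).2.2.2.1; omega
    have hMuR : (Mu O.merged) < (KS0.R'0 κ Φ t p O.merged mk) := by unfold KS0.reach0 at hReach; omega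
    have hML : (Mu O.merged) ≤ ML κ Φ t p O.merged (KS.gT mk gx κ Φ t p O.merged) := Mu_le_ML κ Φ t p O.merged (KS.gT mk gx κ Φ t p O.merged)
    have hn := hNL.n_le
    have hkn : O.merged.k ≤ (nL κ Φ t p O.merged (KS.gT mk gx κ Φ t p O.merged) (KS.fT mk fx κ Φ t p O.merged)) := by have := hkMu.2; omega
    have hℓ : 11 * O.merged.k ≤ 3 * (ℓL κ Φ t p O.merged (KS.gT mk gx κ Φ t p O.merged) (KS.fT mk fx κ Φ t p O.merged)) := by have := hkMu.2; have := hNL.ℓ_le; have := hMLR; omega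
    have hR : Skelφ.fatRadius Φ.frame hC O.merged.k ≤ (RL κ Φ t p O (KS.gT mk gx) (KS.fT mk fx)) := by
      have hReq' : ∀ n, O.merged.R n = Skelφ.fatRadius Φ.frame hC n := fun n => congrFun hReq n
      unfold RL; rw [hReq']
      exact Skelφ.fatRadius_mono Φ.frame hC (le_trans hkn (le_max_left _ _))
    unfold φL
    exact Skelφ.fatSeq_subset_pgramPrismFin Φ.frame hC _ hkn hκ10 hℓ hR
  exact faceOblRM_frmBVC₂ (Sv := (SUS ex mx)) (kF := (fun I : Fin 2 => (prFA κ Φ t p O.merged (KS.gT mk gx κ Φ t p O.merged) (KS.fT mk fx κ Φ t p O.merged)).kFF₂V (fcellsV κ Φ t p O.merged (KS.gT mk gx κ Φ t p O.merged) (KS.fT mk fx κ Φ t p O.merged) (cOf κ Φ t p O (KS.gT mk gx) (KS.fT mk fx) cv) (hOf κ Φ t p O (KS.gT mk gx) (KS.fT mk fx) hv)) (KS0.Rlev0 κ Φ t p O.merged mk) I)) (η := (Neg.η κ Φ)) (m := (mRS κ Φ t p O.merged (KS.gT mk gx κ Φ t p O.merged) (KS.fT mk fx κ Φ t p O.merged)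 (mx κ Φ t p O.merged (KS.gT mk gx κ Φ t p O.merged) (KS.fT mk fx κ Φ t p O.merged)))) (Δg := Φ.Δ) (nFc := (fun I : Fin 2 => (((prFA κ Φ t p O.merged (KS.gT mk gx κ Φ t p O.merged) (KS.fT mk fx κ Φ t p O.merged)).cOf I * |(prFA κ Φ t p O.merged (KS.gT mk gx κ Φ t p O.merged) (KS.fT mk fx κ Φ t p O.merged)).A| * |(prFA κ Φ t p O.merged (KS.gT mk gx κ Φ t p O.merged) (KS.fT mk fx κ Φ t p O.merged)).lvGen I ((prFA κ Φ t p O.merged (KS.gT mk gx κ Φ t p O.merged) (KS.fT mk fx κ Φ t p O.merged)).bOf I)|).toNat))) (kq := 10) (δ := (Neg.δkit κ Φ)) (ηk := (Neg.η κ Φ)) (Rs := (KS.Rs t O.merged mk)) (KCmaxb := (KS.KCmax t O.merged mk)) (KCmaxr := (KS.KCmax t O.merged mk)) (rsb := (KS0.rs0 t O.merged mk)) (rsr := (KS0.rs0 t O.merged mk)) (cSb := (KS0.cS0 Φ t O.merged mk)) (cSr := (KS0.cS0 Φ t O.merged mk)) (cU := (KS.cUA Φ t O.merged mk)) (r₁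 := Rb) (r₂ := (RL κ Φ t p O (KS.gT mk gx) (KS.fT mk fx))) (ρZ := (Skelφ.fatRadius Φ.frame hC O.merged.k)) (R₁k := ((SUS ex mx κ Φ t p O.merged (KS.gT mk gx κ Φ t p O.merged) (KS.fT mk fx κ Φ t p O.merged) q).Rex (Skelφ.fatRadius Φ.frame hC O.merged.k))) (nz := (Mu O.merged)) (KCmax := (KS.KCmax t O.merged mk)) (rs := (KS0.rs0 t O.merged mk)) (cS := (KS0.cS0 Φ t O.merged mk)) mk cW gx fx hgx hfx hAt hb1v (prFA_D_pos κ Φ t p O.merged (KS.gT mk gx κ Φ t p O.merged) (KS.fT mk fx κ Φ t p O.merged) hNL) (fun n => le_trans hL' (hgapL_US κ Φ t p O.merged (KS.gT mk gx κ Φ t p O.merged) (KS.fT mk fx κ Φ t p O.merged) ex mx q n)) (hgap20_US κ Φ t p O.merged (KS.gT mk gx κ Φ t p O.merged) (KS.fT mk fx κ Φ t p O.merged) ex mx q) (hgapc_US κ Φ t p O.merged (KS.gT mk gx κ Φ t p O.merged) (KS.fT mk fx κ Φ t p O.merged) ex mx q) (le_trans (by norm_num) (three_le_E₀_US κ Φ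 t p O.merged (KS.gT mk gx κ Φ t p O.merged) (KS.fT mk fx κ Φ t p O.merged) ex mx q).1) hL' (KS0.Rlev0 κ Φ t p O.merged mk) (KS0.Nk0 κ Φ t p O.merged mk) (KS0.j₀0 t O.merged mk - 1) (frame_hRlevV κ Φ t p O.merged (KS.fT mk fx κ Φ t p O.merged) mk gx hNL hκ10 hMR0 (fcellsV κ Φ t p O.merged (KS.gT mk gx κ Φ t p O.merged) (KS.fT mk fx κ Φ t p O.merged) (cOf κ Φ t p O (KS.gT mk gx) (KS.fT mk fx) cv) (hOf κ Φ t p O (KS.gT mk gx) (KS.fT mk fx) hv)) hPC) (frame_hRlev'V κ Φ t p O.merged (KS.fT mk fx κ Φ t p O.merged) mk gx hNL hκ10 hMR0 (fcellsV κ Φ t p O.merged (KS.gT mk gx κ Φ t p O.merged) (KS.fT mk fx κ Φ t p O.merged) (cOf κ Φ t p O (KS.gT mk gx) (KS.fT mk fx) cv) (hOf κ Φ t p O (KS.gT mk gx) (KS.fT mk fx) hv)) hPC) (fun du : MDir => (((prFA κ Φ t p O.merged (KS.gT mk gx κ Φ t p O.merged) (KS.fT mk fx κ Φ t p O.merged)).awF₂V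 (fcellsV κ Φ t p O.merged (KS.gT mk gx κ Φ t p O.merged) (KS.fT mk fx κ Φ t p O.merged) (cOf κ Φ t p O (KS.gT mk gx) (KS.fT mk fx) cv) (hOf κ Φ t p O (KS.gT mk gx) (KS.fT mk fx) hv)) du).toNat)) (frame_hk₀V κ Φ t p O.merged (KS.fT mk fx κ Φ t p O.merged) mk gx hNL hκ10) (frame_hk₀'V κ Φ t p O.merged (KS.fT mk fx κ Φ t p O.merged) mk gx hNL hκ10 (fcellsV κ Φ t p O.merged (KS.gT mk gx κ Φ t p O.merged) (KS.fT mk fx κ Φ t p O.merged) (cOf κ Φ t p O (KS.gT mk gx) (KS.fT mk fx) cv) (hOf κ Φ t p O (KS.gT mk gx) (KS.fT mk fx) hv)) hPC) (frame_hroomFV κ Φ t p O.merged (KS.fT mk fx κ Φ t p O.merged) mk gx hNL (fcellsV κ Φ t p O.merged (KS.gT mk gx κ Φ t p O.merged) (KS.fT mk fx κ Φ t p O.merged) (cOf κ Φ t p O (KS.gT mk gx) (KS.fT mk fx) cv) (hOf κ Φ t p O (KS.gT mk gx) (KS.fT mk fx) hv))) (frame_hkFV κ Φ t p O.merged (KS.fT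 mk fx κ Φ t p O.merged) mk gx hNL hκ10 hMR0 (fcellsV κ Φ t p O.merged (KS.gT mk gx κ Φ t p O.merged) (KS.fT mk fx κ Φ t p O.merged) (cOf κ Φ t p O (KS.gT mk gx) (KS.fT mk fx) cv) (hOf κ Φ t p O (KS.gT mk gx) (KS.fT mk fx) hv)) hPC) (frame_hawV κ Φ t p O.merged (KS.fT mk fx κ Φ t p O.merged) mk gx hNL (fcellsV κ Φ t p O.merged (KS.gT mk gx κ Φ t p O.merged) (KS.fT mk fx κ Φ t p O.merged) (cOf κ Φ t p O (KS.gT mk gx) (KS.fT mk fx) cv) (hOf κ Φ t p O (KS.gT mk gx) (KS.fT mk fx) hv))) hcountv hη2 ((SUS ex mx κ Φ t p O.merged (KS.gT mk gx κ Φ t p O.merged) (KS.fT mk fx κ Φ t p O.merged) q).Rex) hR1v hdiamv (hgapR_US κ Φ t p O.merged (KS.gT mk gx κ Φ t p O.merged) (KS.fT mk fx κ Φ t p O.merged) ex mx q) hΔg hA0 hnL hvL hmf (fun I => (frame_nFcV κ Φ t p O.merged (KS.fT mk fx κ Φ t p O.merged) mk gx hNL hκ10 I).1) (fun I => (frame_nFcV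 κ Φ t p O.merged (KS.fT mk fx κ Φ t p O.merged) mk gx hNL hκ10 I).2) κ.hδ₂0 hB hκ10 (RL κ Φ t p O (KS.gT mk gx) (KS.fT mk fx)) hlay (KS0.Rlev0 κ Φ t p O.merged mk) (KS0.Nk0 κ Φ t p O.merged mk) (KS0.j₀0 t O.merged mk) (KS0.j₁0 κ Φ t p O.merged mk) (KS0.Rlev0 κ Φ t p O.merged mk) (KS0.Nk0 κ Φ t p O.merged mk) (KS0.j₀0 t O.merged mk) (KS0.j₁0 κ Φ t p O.merged mk) (KS0.Rlev0 κ Φ t p O.merged mk) (KS0.Nk0 κ Φ t p O.merged mk) (KS0.j₀0 t O.merged mk) (KS0.j₁0 κ Φ t p O.merged mk) hRl₁ (KS0.R'0_eq κ Φ t p O.merged mk).2.1.le (KS0.R'0_eq κ Φ t p O.merged mk).2.1.le (KS0.R'0_eq κ Φ t p O.merged mk).2.2 (KS0.R'0_eq κ Φ t p O.merged mk).2.2 (KS0.R'0_eq κ Φ t p O.merged mk).2.2 hB0 hRlr hΛR hΛQ0 hΛQ1 hΛZ hkA0 hkA1 hkbMz hπ1 hclr₁ (Neg.δkit_pos κ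 Φ) (Neg.δkit_le_one κ Φ) nB hchain hcnt.2 hcnt.2 hcnt.2 (Neg.η_pos κ Φ).2.1 (KS0.kit0 t O.merged mk ((((Mu O.merged)) : ℤ) + 2) (KS0.r₀0 t O.merged mk Rb)) (KS0.kit0 t O.merged mk (((((Mu O.merged)) + 1 : ℕ) : ℤ) * ((shearUnit (nL κ Φ t p O.merged (KS.gT mk gx κ Φ t p O.merged) (KS.fT mk fx κ Φ t p O.merged)) (prFA κ Φ t p O.merged (KS.gT mk gx κ Φ t p O.merged) (KS.fT mk fx κ Φ t p O.merged)).h) : ℤ) + 1) (KS0.r₀0 t O.merged mk (RL κ Φ t p O (KS.gT mk gx) (KS.fT mk fx)))) (KS0.kit0_ok t O.merged mk ((((Mu O.merged)) : ℤ) + 2) (KS0.r₀0 t O.merged mk Rb) (kq := 0) (by norm_num)).2.2.2.2.2 rfl (KS0.kit0_ok t O.merged mk ((((Mu O.merged)) : ℤ) + 2) (KS0.r₀0 t O.merged mk Rb) (kq := 0) (by norm_num)).2.1 (KS0.kit0_ok t O.merged mk ((((Mu O.merged)) : ℤ) + 2) (KS0.r₀0 t O.merged mk Rb) (kq := 0)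 (by norm_num)).2.2.1 hKCb hwideb hdwb hDwb (KS0.kit0_ok t O.merged mk ((((Mu O.merged)) : ℤ) + 2) (KS0.r₀0 t O.merged mk Rb) (kq := 0) (by norm_num)).2.2.2.2.1 (KS0.hr₀_kit0 t O.merged mk ((((Mu O.merged)) : ℤ) + 2) (KS0.r₀0_ge t O.merged mk Rb).1).1 hRb₀ (KS0.kit0_sizes Φ t O.merged mk ((((Mu O.merged)) : ℤ) + 2) (KS0.r₀0 t O.merged mk Rb)).1 (KS0.kit0_sizes Φ t O.merged mk ((((Mu O.merged)) : ℤ) + 2) (KS0.r₀0 t O.merged mk Rb)).2 hEb (KS0.hreach_kit0 t O.merged mk ((((Mu O.merged)) : ℤ) + 2) (KS0.r₀0_ge t O.merged mk Rb).2) le_rfl hr₁R (KS0.kit0_ok t O.merged mk (((((Mu O.merged)) + 1 : ℕ) : ℤ) * ((shearUnit (nL κ Φ t p O.merged (KS.gT mk gx κ Φ t p O.merged) (KS.fT mk fx κ Φ t p O.merged)) (prFA κ Φ t p O.merged (KS.gT mk gx κ Φ t p O.merged) (KS.fT mk fx κ Φ t p O.merged)).h) : ℤ) + 1) (KS0.r₀0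 t O.merged mk (RL κ Φ t p O (KS.gT mk gx) (KS.fT mk fx))) (kq := 10) le_rfl).1 rfl (KS0.kit0_ok t O.merged mk (((((Mu O.merged)) + 1 : ℕ) : ℤ) * ((shearUnit (nL κ Φ t p O.merged (KS.gT mk gx κ Φ t p O.merged) (KS.fT mk fx κ Φ t p O.merged)) (prFA κ Φ t p O.merged (KS.gT mk gx κ Φ t p O.merged) (KS.fT mk fx κ Φ t p O.merged)).h) : ℤ) + 1) (KS0.r₀0 t O.merged mk (RL κ Φ t p O (KS.gT mk gx) (KS.fT mk fx))) (kq := 10) le_rfl).2.1 (KS0.kit0_ok t O.merged mk (((((Mu O.merged)) + 1 : ℕ) : ℤ) * ((shearUnit (nL κ Φ t p O.merged (KS.gT mk gx κ Φ t p O.merged) (KS.fT mk fx κ Φ t p O.merged)) (prFA κ Φ t p O.merged (KS.gT mk gx κ Φ t p O.merged) (KS.fT mk fx κ Φ t p O.merged)).h) : ℤ) + 1) (KS0.r₀0 t O.merged mk (RL κ Φ t p O (KS.gT mk gx) (KS.fT mk fx))) (kq := 10) le_rfl).2.2.1 (KS0.kit0_ok t O.merged mk (((((Mu O.merged)) + 1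 : ℕ) : ℤ) * ((shearUnit (nL κ Φ t p O.merged (KS.gT mk gx κ Φ t p O.merged) (KS.fT mk fx κ Φ t p O.merged)) (prFA κ Φ t p O.merged (KS.gT mk gx κ Φ t p O.merged) (KS.fT mk fx κ Φ t p O.merged)).h) : ℤ) + 1) (KS0.r₀0 t O.merged mk (RL κ Φ t p O (KS.gT mk gx) (KS.fT mk fx))) (kq := 10) le_rfl).2.2.2.1 (fun N0 k hk j hj _ i => Skelφ.icc_level_room (hcoreX (KS0.R'0 κ Φ t p O.merged mk) (KS.qBXFs κ Φ t p O.merged mk) N0 k hk) hj (hwA _ _) i) (fun N0 k hk j hj _ i => Skelφ.icc_level_room (hcoreX (KS0.R'0 κ Φ t p O.merged mk) (KS.qBXFs κ Φ t p O.merged mk) N0 k hk) hj (hwD _ _) i) (fun N0 k hk j hj _ i => Skelφ.icc_level_room (hcoreX (KS0.R'0 κ Φ t p O.merged mk) (KS.qBXFs κ Φ t p O.merged mk) N0 k hk) hj (hwDD _ _) i) (fun N0 k hk j hj _ i => Skelφ.icc_level_room (hcoreY (KS0.R'0 κ Φ t p O.merged mk) (KS.qB3XA κ Φ t p O.merged (KS.gT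 mk gx κ Φ t p O.merged) (KS.fT mk fx κ Φ t p O.merged) (KS0.R'0 κ Φ t p O.merged mk)) N0 k hk) hj (hwA _ _) i) (fun N0 k hk j hj _ i => Skelφ.icc_level_room (hcoreY (KS0.R'0 κ Φ t p O.merged mk) (KS.qB3XA κ Φ t p O.merged (KS.gT mk gx κ Φ t p O.merged) (KS.fT mk fx κ Φ t p O.merged) (KS0.R'0 κ Φ t p O.merged mk)) N0 k hk) hj (hwD _ _) i) (fun N0 k hk j hj _ i => Skelφ.icc_level_room (hcoreY (KS0.R'0 κ Φ t p O.merged mk) (KS.qB3XA κ Φ t p O.merged (KS.gT mk gx κ Φ t p O.merged) (KS.fT mk fx κ Φ t p O.merged) (KS0.R'0 κ Φ t p O.merged mk)) N0 k hk) hj (hwDD _ _) i) (fun N0 k hk j hj _ i => Skelφ.icc_level_room (hcoreY (KS0.R'0 κ Φ t p O.merged mk) (KS.qBF κ Φ t p O.merged cW mk (KS.gT mk gx κ Φ t p O.merged) (KS.fT mk fx κ Φ t p O.merged)) N0 k hk) hj (hwA _ _) i) (fun N0 k hk j hj _ i => Skelφ.icc_level_room (hcoreY (KS0.R'0 κ Φ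 t p O.merged mk) (KS.qBF κ Φ t p O.merged cW mk (KS.gT mk gx κ Φ t p O.merged) (KS.fT mk fx κ Φ t p O.merged)) N0 k hk) hj (hwD _ _) i) (fun N0 k hk j hj _ i => Skelφ.icc_level_room (hcoreY (KS0.R'0 κ Φ t p O.merged mk) (KS.qBF κ Φ t p O.merged cW mk (KS.gT mk gx κ Φ t p O.merged) (KS.fT mk fx κ Φ t p O.merged)) N0 k hk) hj (hwDD _ _) i) (fun N0 k hk j hj _ i => Skelφ.icc_level_room (hcoreX (KS0.R'0 κ Φ t p O.merged mk) (KS.qB3YA κ Φ t p O.merged (KS.gT mk gx κ Φ t p O.merged) (KS.fT mk fx κ Φ t p O.merged) (KS0.R'0 κ Φ t p O.merged mk)) N0 k hk) hj (hwA _ _) i) (fun N0 k hk j hj _ i => Skelφ.icc_level_room (hcoreX (KS0.R'0 κ Φ t p O.merged mk) (KS.qB3YA κ Φ t p O.merged (KS.gT mk gx κ Φ t p O.merged) (KS.fT mk fx κ Φ t p O.merged) (KS0.R'0 κ Φ t p O.merged mk)) N0 k hk) hj (hwD _ _) i) (fun N0 k hk j hj _ i => Skelφ.icc_level_room (hcoreX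 (KS0.R'0 κ Φ t p O.merged mk) (KS.qB3YA κ Φ t p O.merged (KS.gT mk gx κ Φ t p O.merged) (KS.fT mk fx κ Φ t p O.merged) (KS0.R'0 κ Φ t p O.merged mk)) N0 k hk) hj (hwDD _ _) i) (KS0.kit0_ok t O.merged mk (((((Mu O.merged)) + 1 : ℕ) : ℤ) * ((shearUnit (nL κ Φ t p O.merged (KS.gT mk gx κ Φ t p O.merged) (KS.fT mk fx κ Φ t p O.merged)) (prFA κ Φ t p O.merged (KS.gT mk gx κ Φ t p O.merged) (KS.fT mk fx κ Φ t p O.merged)).h) : ℤ) + 1) (KS0.r₀0 t O.merged mk (RL κ Φ t p O (KS.gT mk gx) (KS.fT mk fx))) (kq := 10) le_rfl).2.2.2.2.1 (KS0.hr₀_kit0 t O.merged mk (((((Mu O.merged)) + 1 : ℕ) : ℤ) * ((shearUnit (nL κ Φ t p O.merged (KS.gT mk gx κ Φ t p O.merged) (KS.fT mk fx κ Φ t p O.merged)) (prFA κ Φ t p O.merged (KS.gT mk gx κ Φ t p O.merged) (KS.fT mk fx κ Φ t p O.merged)).h) : ℤ) + 1) (KS0.r₀0_ge t O.merged mk (RL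 κ Φ t p O (KS.gT mk gx) (KS.fT mk fx))).1).1 hRr₀ (KS0.kit0_sizes Φ t O.merged mk (((((Mu O.merged)) + 1 : ℕ) : ℤ) * ((shearUnit (nL κ Φ t p O.merged (KS.gT mk gx κ Φ t p O.merged) (KS.fT mk fx κ Φ t p O.merged)) (prFA κ Φ t p O.merged (KS.gT mk gx κ Φ t p O.merged) (KS.fT mk fx κ Φ t p O.merged)).h) : ℤ) + 1) (KS0.r₀0 t O.merged mk (RL κ Φ t p O (KS.gT mk gx) (KS.fT mk fx)))).1 (KS0.kit0_sizes Φ t O.merged mk (((((Mu O.merged)) + 1 : ℕ) : ℤ) * ((shearUnit (nL κ Φ t p O.merged (KS.gT mk gx κ Φ t p O.merged) (KS.fT mk fx κ Φ t p O.merged)) (prFA κ Φ t p O.merged (KS.gT mk gx κ Φ t p O.merged) (KS.fT mk fx κ Φ t p O.merged)).h) : ℤ) + 1) (KS0.r₀0 t O.merged mk (RL κ Φ t p O (KS.gT mk gx) (KS.fT mk fx)))).2 (hreach0 _ _) (hreach0 _ _) (KS0.hreach_kit0 t O.merged mk (((((Mu O.merged)) + 1 : ℕ) : ℤ) * ((shearUnit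 (nL κ Φ t p O.merged (KS.gT mk gx κ Φ t p O.merged) (KS.fT mk fx κ Φ t p O.merged)) (prFA κ Φ t p O.merged (KS.gT mk gx κ Φ t p O.merged) (KS.fT mk fx κ Φ t p O.merged)).h) : ℤ) + 1) (KS0.r₀0_ge t O.merged mk (RL κ Φ t p O (KS.gT mk gx) (KS.fT mk fx))).2) le_rfl hr₂R (KS.RgK G t O.merged mk (KS.φK Φ t O.D O.DT.toDataN O.ori mk)) (KS.RgK_subset_graphBall t O.merged mk (KS.φK Φ t O.D O.DT.toDataN O.ori mk)) (KS.card_RgK_le Φ t O.merged mk (KS.φK Φ t O.D O.DT.toDataN O.ori mk)) (KS.hcU1_at Φ t O.merged mk) O.merged.Λ O.merged.k hΛv hclrz (hczK_of_atQ hAt3) (hzconnK_of_atQ hAt3) hRsr (hZρK_of_atQ hAt3) hρr hZUv Qb Fb hQb hFb (KS0.kk0 κ Φ t p O.merged mk) (KS0.kk0 κ Φ t p O.merged mk) (KS0.kk0 κ Φ t p O.merged mk) hNk hNk hNk hcnt.1 hcnt.1 hcnt.1 hbridge (hlongK_of_atQ3 hAt3 h1 le_rfl) (hlongYK_of_atQ3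 hAt3 h1 le_rfl) (fun c' R' hR' => hRex_US κ Φ t p O.merged (KS.gT mk gx κ Φ t p O.merged) (KS.fT mk fx κ Φ t p O.merged) ex mx q hCq (oL κ Φ t p O.D O.DT.toDataN O.ori (KS.gT mk gx κ Φ t p O.merged) (KS.fT mk fx κ Φ t p O.merged)) (le_refl (Neg.η κ Φ)) c' (Skelφ.fatRadius Φ.frame hC O.merged.k) R' hR') hR₁b hR₁r (KS0.kit0 t O.merged mk (((((Mu O.merged)) + 1 : ℕ) : ℤ) * (prFA κ Φ t p O.merged (KS.gT mk gx κ Φ t p O.merged) (KS.fT mk fx κ Φ t p O.merged)).D + 1) (KS0.r₀0 t O.merged mk r)) (le_trans (by norm_num) (KS0.kit0_ok t O.merged mk (((((Mu O.merged)) + 1 : ℕ) : ℤ) * (prFA κ Φ t p O.merged (KS.gT mk gx κ Φ t p O.merged) (KS.fT mk fx κ Φ t p O.merged)).D + 1) (KS0.r₀0 t O.merged mk r) (kq := 2) (by norm_num)).1) rfl (KS0.kit0_ok t O.merged mk (((((Mu O.merged)) + 1 : ℕ) : ℤ) * (prFA κ Φ t p O.merged (KS.gT mk gx κ Φ t p O.merged)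 (KS.fT mk fx κ Φ t p O.merged)).D + 1) (KS0.r₀0 t O.merged mk r) (kq := 2) (by norm_num)).2.1 (KS0.kit0_ok t O.merged mk (((((Mu O.merged)) + 1 : ℕ) : ℤ) * (prFA κ Φ t p O.merged (KS.gT mk gx κ Φ t p O.merged) (KS.fT mk fx κ Φ t p O.merged)).D + 1) (KS0.r₀0 t O.merged mk r) (kq := 2) (by norm_num)).2.2.1 (KS0.kit0_ok t O.merged mk (((((Mu O.merged)) + 1 : ℕ) : ℤ) * (prFA κ Φ t p O.merged (KS.gT mk gx κ Φ t p O.merged) (KS.fT mk fx κ Φ t p O.merged)).D + 1) (KS0.r₀0 t O.merged mk r) (kq := 2) (by norm_num)).2.2.2.1 hMtanv hMdv hMDv (KS0.kit0_ok t O.merged mk (((((Mu O.merged)) + 1 : ℕ) : ℤ) * (prFA κ Φ t p O.merged (KS.gT mk gx κ Φ t p O.merged) (KS.fT mk fx κ Φ t p O.merged)).D + 1) (KS0.r₀0 t O.merged mk r) (kq := 2) (by norm_num)).2.2.2.2.1 (KS0.hr₀_kit0 t O.merged mk (((((Mu O.merged)) + 1 : ℕ) : ℤ) * (prFA κ Φ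 t p O.merged (KS.gT mk gx κ Φ t p O.merged) (KS.fT mk fx κ Φ t p O.merged)).D + 1) (KS0.r₀0_ge t O.merged mk r).1).1 hr₀L (KS0.kit0_sizes Φ t O.merged mk (((((Mu O.merged)) + 1 : ℕ) : ℤ) * (prFA κ Φ t p O.merged (KS.gT mk gx κ Φ t p O.merged) (KS.fT mk fx κ Φ t p O.merged)).D + 1) (KS0.r₀0 t O.merged mk r)).1 (KS0.kit0_sizes Φ t O.merged mk (((((Mu O.merged)) + 1 : ℕ) : ℤ) * (prFA κ Φ t p O.merged (KS.gT mk gx κ Φ t p O.merged) (KS.fT mk fx κ Φ t p O.merged)).D + 1) (KS0.r₀0 t O.merged mk r)).2 (hreachE) (KS0.hreach_kit0 t O.merged mk (((((Mu O.merged)) + 1 : ℕ) : ℤ) * (prFA κ Φ t p O.merged (KS.gT mk gx κ Φ t p O.merged) (KS.fT mk fx κ Φ t p O.merged)).D + 1) (KS0.r₀0_ge t O.merged mk r).2) (KS0.kk0 κ Φ t p O.merged mk) hNk (KS0.counts_atq_face κ Φ t p O.merged mk hp0 hp1 hq1 hq2).1 hroomX hroomY hZk hkEr hkE2 hfwdX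 hkE hkE8 hkE24 hfwdY hfwdYx hc600 hrX hrY hnB840

end NegB

end PlanarSkeletonFrmFrom

end Summit.CriticalPhenomena.PercolationContinuityZ3.Theorems.Transplant

end
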